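import Summits.PneNP.PneNP.Theorems.PermanentDescentCollapseMakesPermanentEasyDefs
import Literature.Computability.Complexity.CodeFPArith
import Literature.Computability.Complexity.CodeFPStrings
import Literature.Computability.Complexity.CodeFPTableKit
import Literature.Computability.Complexity.CodeFPLists

/-!
# Route PermanentDescent, crux `CollapseMakesPermanentEasy` (stmt-PneNP-16142), line `birth` v2 — `stub_ansValFP`

Registered stub `stub_ansValFP` of the skeleton `Cruxes/CollapseMakesPermanentEasy/Lines/birth.lean` (v2), over the
objects of `Theorems/PermanentDescentCollapseMakesPermanentEasyDefs.lean` (namespace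
`Summit.PneNP.PneNP.Theorems.PermCert`). The table answer `ansT χ W s i` and the table value `valT χ W B s`
are computed on codes in polynomial time, assembled in the typed calculus `CodeFP` with no machine written:
the query `⟨s, bin i⟩` IS the code of the pair `(s, i)` (`transparent`), its length is `strLength`/`natOfUn`,
the table entry is `rawGetD`, the final pairing is `transparent` again, and `χ` is applied by `comp`; the
value is the contextual `map` of the answer over `urange B` (context `(W, s)`), read back as a string by
`bitsToStr` and valued by `strVal`. Every identification of functions is definitional (`congr … rfl`).
-/

set_option linter.dupNamespace false -- `Summit.PneNP.PneNP.…`: summit = sub-problem name (D-0017 single-conjunct layout)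

namespace Summit.PneNP.PneNP.Theorems.PermCert

open _root_.Computability Polynomial
open Literature.Computability.Complexity Literature.Computability.Complexity.Brick
  Literature.Computability.Complexity.CodeFP

/-- **The table answer is polynomial time on codes.** For a polynomial-time bit `χ`, the map
`(W, s, i) ↦ ansT χ W s i = χ ⟨⟨s, bin i⟩, W[|⟨s, bin i⟩|]⟩` is `CodeFP` from
`pairE (rawE strE) (pairE strE natE)` to `bitE` (query by `transparent`, length by `strLength`/`natOfUn`,
entry by `rawGetD`). [cite: AroraBarakCC2009, §1.3 (closure of polynomial time under composition)] -/
theorem ansT_codeFP {χ : List Bool → Bool} (hχ : CodeFP strE bitE χ) :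
    CodeFP (pairE (rawE strE) (pairE strE natE)) bitE (fun t => ansT χ t.1 t.2.1 t.2.2) := by
  -- the query string `⟨s, bin i⟩` is the code of the pair `(s, i)`
  have hq0 : CodeFP (pairE strE natE) strE (fun p => boolPair p.1 (encodeNat p.2)) :=
    transparent fun _ => rfl
  have hq : CodeFP (pairE (rawE strE) (pairE strE natE)) strE
      (fun t => boolPair t.2.1 (encodeNat t.2.2)) :=
    hq0.comp (snd _ _)
  -- its length, as a binary numeral
  have hlen : CodeFP (pairE (rawE strE) (pairE strE natE)) natE
      (fun t => (boolPair t.2.1 (encodeNat t.2.2)).length) :=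
    (natOfUn.comp (strLength.comp hq) :)
  -- the table entry at that index (default `[]`, coded by `ε`)
  have hadv : CodeFP (pairE (rawE strE) (pairE strE natE)) strE
      (fun t => t.1.getD (boolPair t.2.1 (encodeNat t.2.2)).length []) :=
    ((rawGetD strE (d := ([] : List Bool)) rfl).comp ((fst _ _).pair hlen)).congr fun _ => rfl
  -- pairing the query with the entry is again the identity on codes
  have hp0 : CodeFP (pairE strE strE) strE (fun p => boolPair p.1 p.2) := transparent fun _ => rfl
  have harg : CodeFP (pairE (rawE strE) (pairE strE natE)) strE
      (fun t => boolPair (boolPair t.2.1 (encodeNat t.2.2))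
        (t.1.getD (boolPair t.2.1 (encodeNat t.2.2)).length [])) :=
    hp0.comp (hq.pair hadv)
  exact (hχ.comp harg).congr fun _ => rfl

/-- **The table value is polynomial time on codes.** For a polynomial-time bit `χ`, the map
`(W, B, s) ↦ valT χ W B s` (bit budget `B` in unary) is `CodeFP` from `pairE (rawE strE) (pairE unE strE)`
to `natE`: the answers `ansT χ W s i`, `i < B`, are the contextual `map` (context `(W, s)`) of
`ansT_codeFP` over `urange B`, turned into a string by `bitsToStr` and valued by `strVal`.
[cite: AroraBarakCC2009, §1.3 (closure of polynomial time under polynomially bounded loops)] -/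
theorem valT_codeFP {χ : List Bool → Bool} (hχ : CodeFP strE bitE χ) :
    CodeFP (pairE (rawE strE) (pairE unE strE)) natE (fun t => valT χ t.1 t.2.1 t.2.2) := by
  -- the answer with context `σ = (W, s)` and item `i`: re-pair `((W, s), i) ↦ (W, (s, i))`
  have hre : CodeFP (pairE (pairE (rawE strE) strE) natE) (pairE (rawE strE) (pairE strE natE))
      (fun q => (q.1.1, (q.1.2, q.2))) :=
    (fst _ _).fst'.pair (((fst _ _).snd').pair (snd _ _))
  have hg : CodeFP (pairE (pairE (rawE strE) strE) natE) bitE (fun q => ansT χ q.1.1 q.1.2 q.2) :=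
    ((ansT_codeFP hχ).comp hre).congr fun _ => rfl
  -- map it over the range `[0, …, B - 1]` (from the unary budget `B`)
  have hmap : CodeFP (pairE (pairE (rawE strE) strE) (rawE natE)) (rawE bitE)
      (fun p => p.2.map fun i => ansT χ p.1.1 p.1.2 i) :=
    (map hg).congr fun _ => rfl
  have hR : CodeFP (pairE (rawE strE) (pairE unE strE)) (pairE (pairE (rawE strE) strE) (rawE natE))
      (fun t => ((t.1, t.2.2), List.range t.2.1)) :=
    ((fst _ _).pair (snd _ _).snd').pair (urange.comp (snd _ _).fst')
  have hbits : CodeFP (pairE (rawE strE) (pairE unE strE)) (rawE bitE)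
      (fun t => (List.range t.2.1).map fun i => ansT χ t.1 t.2.2 i) :=
    (hmap.comp hR).congr fun _ => rfl
  -- read the bit list as a string and take its value
  exact (strVal.comp (bitsToStr.comp hbits)).congr fun _ => rfl

/-- **Stub FA (table answers and values are polynomial time).** For a polynomial-time bit `χ`, the
answer `(W, s, i) ↦ ansT χ W s i` and the value `(W, B, s) ↦ valT χ W B s` (bit budget `B` in unary) are
computed on codes in polynomial time (`ansT_codeFP`, `valT_codeFP`: pairing `transparent`,
`strLength`/`natOfUn`, `rawGetD`, `urange`, `map`, `bitsToStr`, `strVal`).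
[cite: AroraBarakCC2009, §1.3 (polynomial-time computable functions; composition and bounded loops)] -/
theorem stub_ansValFP :
    ∀ χ : List Bool → Bool, CodeFP strE bitE χ →
      CodeFP (pairE (rawE strE) (pairE strE natE)) bitE (fun t => ansT χ t.1 t.2.1 t.2.2) ∧
        CodeFP (pairE (rawE strE) (pairE unE strE)) natE (fun t => valT χ t.1 t.2.1 t.2.2) :=
  fun _ hχ => ⟨ansT_codeFP hχ, valT_codeFP hχ⟩

end Summit.PneNP.PneNP.Theorems.PermCert
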